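import Summits.AtomisticToContinuum.Crystallization.Theorems.ChargedEnergyGapLabelledCovering
import HarnessLib

/-!
# Charged energy gap — lens-3 g63, part P-Z₄b: DISTINCT SITES from disjoint covering balls (multiplicity control for the charging)

Cell `decomp-a2c`, seat lens-3, generation 63, part P-Z₄b (after P-Z₁ `ChargedEnergyGapLabelledCovering`).  ELEMENTARY·PROVED.
The carrier of P-Z₄ is found by an ARBITRARY selector of sites within the covering radius `219/100`; any load estimate (P-Z₅) must count
carriers WITHOUT multiplicity.  The device: sites selected in balls whose CENTRES are more than `438/100 = 2·219/100` apart are pairwise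
DISTINCT (`injective_of_far_centres`), so `k` centres at spacing `44/10` along any unit direction yield `k` distinct sites of the reference, the
`i`-th within `219/100` of the `i`-th centre (`exists_distinct_sites_on_line`); in particular every closed ball of radius `44/10·(k − 1) + 219/100`
contains `k` distinct sites (`exists_distinct_sites_near`).  Used by the fair-share / fractional charging of the bulk far residue (seat HANDOFF §I).
-/

noncomputable section

open scoped Classical

open Literature.MathematicalPhysics.StatisticalMechanics Literature.Geometry.DiscreteGeometry
open Summit.AtomisticToContinuum.Crystallization.Theses.PricedLinkCensus
open Summit.AtomisticToContinuum.Crystallization.Theorems.ChargedEnergyGapNegative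

namespace Summit.AtomisticToContinuum.Crystallization.Theorems.ChargedEnergyGapChartDial

/-- ★ Sites chosen within `219/100` of centres pairwise MORE than `438/100` apart are pairwise distinct. -/
theorem injective_of_far_centres {ι : Type*} {x c : ι → E3} (hx : ∀ i j, i ≠ j → (438 : ℝ) / 100 < dist (x i) (x j))
    (hc : ∀ i, dist (x i) (c i) ≤ 219 / 100) : Function.Injective c := by
  intro i j hij
  by_contra hne
  have h1 := hx i j hne
  have h2 : dist (x i) (x j) ≤ dist (x i) (c i) + dist (c i) (x j) := dist_triangle _ _ _
  have h3 := hc i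
  rw [hij, dist_comm (c j) (x j)] at h2
  rw [hij] at h3
  linarith [hc j]

/-- Centres at spacing `44/10` along a unit direction are pairwise more than `438/100` apart. [formal bookkeeping] -/
theorem dist_lineCentres {u : E3} (hu : ‖u‖ = 1) (x : E3) {i j : ℕ} (hij : i ≠ j) :
    (438 : ℝ) / 100 < dist (x + ((44 : ℝ) / 10 * i) • u) (x + ((44 : ℝ) / 10 * j) • u) := by
  rw [dist_eq_norm, add_sub_add_left_eq_sub, ← sub_smul, norm_smul, hu, mul_one, ← mul_sub, norm_mul, Real.norm_of_nonneg (by norm_num),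
    Real.norm_eq_abs]
  have h1 : (1 : ℝ) ≤ |(i : ℝ) - j| := by
    rcases Nat.lt_or_gt_of_ne hij with h | h
    · have : (i : ℝ) + 1 ≤ j := by exact_mod_cast h
      rw [abs_sub_comm, abs_of_nonneg (by linarith : (0 : ℝ) ≤ (j : ℝ) - i)]
      linarith
    · have : (j : ℝ) + 1 ≤ i := by exact_mod_cast h
      rw [abs_of_nonneg (by linarith : (0 : ℝ) ≤ (i : ℝ) - j)]
      linarith
  nlinarith

/-- ★★ **`k` DISTINCT SITES ALONG ANY LINE**: on a `(lam ≤ 1/3, ℓ ≥ 3)`-labelled reference, for every base point `x`, unit direction `u` and `k`, there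
are `k` pairwise distinct sites `c 0, …, c (k−1)` with `c i` within `219/100` of the centre `x + (44/10·i)•u`. -/
theorem exists_distinct_sites_on_line {lam ℓ : ℝ} {P : PeriodicConfiguration 3} (hL : IsLabelledRef lam ℓ P) (hlam : lam ≤ 1 / 3) (hℓ : 3 ≤ ℓ)
    (x : E3) {u : E3} (hu : ‖u‖ = 1) (k : ℕ) :
    ∃ c : Fin k → E3, Function.Injective c ∧ ∀ i, c i ∈ P.points ∧ dist (x + ((44 : ℝ) / 10 * (i : ℕ)) • u) (c i) ≤ 219 / 100 := by
  choose f hf using fun w : E3 => hL.exists_dist_le hlam hℓ w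
  refine ⟨fun i => f (x + ((44 : ℝ) / 10 * (i : ℕ)) • u), ?_, fun i => hf _⟩
  refine injective_of_far_centres (x := fun i : Fin k => x + ((44 : ℝ) / 10 * (i : ℕ)) • u) (fun i j hij => ?_) fun i => (hf _).2
  exact dist_lineCentres hu x (fun h => hij (Fin.ext h))

/-- ★ **`k` DISTINCT SITES NEAR ANY POINT**: every closed ball of radius `44/10·(k − 1) + 219/100` around any point contains `k` pairwise distinct
sites of a `(lam ≤ 1/3, ℓ ≥ 3)`-labelled reference (e.g. `4` sites within `1539/100`, `8` within `3299/100`; centre the line for half the radius). -/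
theorem exists_distinct_sites_near {lam ℓ : ℝ} {P : PeriodicConfiguration 3} (hL : IsLabelledRef lam ℓ P) (hlam : lam ≤ 1 / 3) (hℓ : 3 ≤ ℓ)
    (x : E3) (k : ℕ) :
    ∃ c : Fin k → E3, Function.Injective c ∧ ∀ i, c i ∈ P.points ∧ dist x (c i) ≤ 44 / 10 * (k - 1 : ℝ) + 219 / 100 := by
  have hu : ‖(EuclideanSpace.single (0 : Fin 3) (1 : ℝ) : E3)‖ = 1 := by
    simp [PiLp.norm_single]
  obtain ⟨c, hc, hcd⟩ := exists_distinct_sites_on_line hL hlam hℓ x hu k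
  refine ⟨c, hc, fun i => ⟨(hcd i).1, ?_⟩⟩
  have hi : ((i : ℕ) : ℝ) ≤ (k - 1 : ℝ) := by
    have h1 : (i : ℕ) + 1 ≤ k := i.isLt
    have h2 : ((i : ℕ) : ℝ) + 1 ≤ (k : ℝ) := by exact_mod_cast h1
    linarith
  have hnorm : dist x (x + ((44 : ℝ) / 10 * (i : ℕ)) • (EuclideanSpace.single (0 : Fin 3) (1 : ℝ) : E3)) = (44 : ℝ) / 10 * (i : ℕ) := by
    rw [dist_eq_norm, sub_add_cancel_left, norm_neg, norm_smul, hu, mul_one, Real.norm_of_nonneg (by positivity)]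
  calc dist x (c i) ≤ dist x (x + ((44 : ℝ) / 10 * (i : ℕ)) • (EuclideanSpace.single (0 : Fin 3) (1 : ℝ) : E3)) +
        dist (x + ((44 : ℝ) / 10 * (i : ℕ)) • (EuclideanSpace.single (0 : Fin 3) (1 : ℝ) : E3)) (c i) := dist_triangle _ _ _
    _ ≤ (44 : ℝ) / 10 * (i : ℕ) + 219 / 100 := by rw [hnorm]; linarith [(hcd i).2]
    _ ≤ 44 / 10 * (k - 1 : ℝ) + 219 / 100 := by nlinarith

/-- ★ **CENTRED form along a segment direction**: for `y ≠ z`, `k` distinct sites within `219/100` of the points `x + (44/10·i)•(z − y)/‖z − y‖`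
— the form used when sharing a pair's load among consecutive well-separated chain centres on its own segment. -/
theorem exists_distinct_sites_along {lam ℓ : ℝ} {P : PeriodicConfiguration 3} (hL : IsLabelledRef lam ℓ P) (hlam : lam ≤ 1 / 3) (hℓ : 3 ≤ ℓ)
    (x : E3) {y z : E3} (hyz : y ≠ z) (k : ℕ) :
    ∃ c : Fin k → E3, Function.Injective c ∧
      ∀ i, c i ∈ P.points ∧ dist (x + ((44 : ℝ) / 10 * (i : ℕ) / ‖z - y‖) • (z - y)) (c i) ≤ 219 / 100 := by
  have hn : 0 < ‖z - y‖ := norm_pos_iff.2 (sub_ne_zero.2 (Ne.symm hyz))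
  have hu : ‖(‖z - y‖⁻¹ • (z - y) : E3)‖ = 1 := by
    rw [norm_smul, norm_inv, norm_norm, inv_mul_cancel₀ hn.ne']
  obtain ⟨c, hc, hcd⟩ := exists_distinct_sites_on_line hL hlam hℓ x hu k
  refine ⟨c, hc, fun i => ⟨(hcd i).1, ?_⟩⟩
  have h := (hcd i).2
  rwa [smul_smul, ← div_eq_mul_inv] at h

end Summit.AtomisticToContinuum.Crystallization.Theorems.ChargedEnergyGapChartDial

end
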